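import Mathlib
import HarnessLib
import HarnessLib.Audit
import Summits.CriticalPhenomena.Statement
import Summits.CriticalPhenomena.Ising3DConformalLimit.Theorems.IsingCFTDataAssembly
import Literature.MathematicalPhysics.QuantumFieldTheory.CFTAxioms
import Literature.Probability.LatticeModels.CFTData

/-!
Route: IsingCFTData

CLOSED (superseded) 2026-08-15T18:06:43Z by planner-rbadge-CriticalPhenomena-IsingCFTData-341f5425-g6-0 — reason: superseded:route-CriticalPhenomena-IsingEuclidUpgrade — superseded by route-CriticalPhenomena-IsingEuclidUpgrade — note: route-repair rbadge g6 (3rd repair seat, after g4/g5): the route cannot be made to conform by any planner verb — two assembly-kind items (stmt-0664 closed/vacuous rev-1 Assembly, stmt-0720 Assembly2) and the gate refuses drop / retriage / merge-restate of assembly items while validating every item e. The file is kept as the record of this route; refuted decls are indexed as negative knowledge (`ledger negatives`).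

# Route IsingCFTData — CFT-data identification of the critical 3D Ising limit plus d=3
non-Gaussianity decide the conjunct

It suffices to show X_I2 = (CFT) ∧ (ND′) (rev 2 content; the rev-3 REPAIR PACKAGE that inlines (CFT)
as this route's own item and removes the two undeclared-conjecture leaves from the cone is prepared
and verified but NOT yet applied — see RATIONALE, last paragraph of NOT DECOMPOSED YET):
(CFT) = crux IsingCFTDataR2IsCFT = crit-ising.S24 (currently typed as the Literature constant
`Literature.MathematicalPhysics.QuantumFieldTheory.CritIsing3DIsCFT`; the rev-3 package restates it
INLINE, same Prop by `Iff.rfl`): there are a renormalisation ρ > 0 on (0,1], a standard family B of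
3-D conformal blocks and unitary ℤ₂-symmetric 3-D CFT data D with exactly one relevant ℤ₂-odd scalar
σ, exactly one relevant non-identity ℤ₂-even scalar ε and convergent crossing-symmetric scalar OPEs
(IsIsingLikeCFT B D) such that for every n, ρ(δ)^n ⟨σ_{[x1/δ]}⋯σ_{[xn/δ]}⟩⁺_{β_c(3)} on ℤ³ →
⟨σ(x1)⋯σ(xn)⟩_D as δ → 0⁺, locally uniformly on non-coincident configurations (Poland–Rychkov–Vichi
2019 §§II–III reading; posed open: DuminilCopinICM2022 §8.4, arXiv:2208.00864 p.29).
(ND′) = crux IsingEuclidUpgradeR4NonGaussian (shared item stmt-CriticalPhenomena-0636): every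
NON-DEGENERATE pointwise scaling limit S of the renormalised critical correlators on ℤ³ (any ρ > 0
on (0,1]) has connected four-point function U₄ ≢ 0.
Deciding theorem (proved in the route file): closes : (CFT) → (ND′) → Ising3DConformalLimit — unpack
the CFT witness (ρ, B, D, h); S := ⟨σ⋯σ⟩_D, Δ := Δ_σ ∈ [1/2, 3) by the unitarity bound (so Δ > 0);
Möbius covariance of S is the covariance axiom of unitary CFT data; S₂(x, y) = ‖x − y‖^{−2Δ_σ} > 0
(two-point normalisation) is non-degeneracy; (ND′) at (ρ, S) gives U₄ ≢ 0.
Lean: `(∃ (ρ : ℝ → ℝ) (B : Literature.Probability.LatticeModels.ConformalBlocks 3) (D :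
Literature.Probability.LatticeModels.CFTData 3) (h :
Literature.Probability.LatticeModels.IsIsingLikeCFT B D), (∀ δ ∈ Set.Ioc (0:ℝ) 1, 0 < ρ δ) ∧
B.IsStandard ∧ Literature.Probability.LatticeModels.HasPointwiseScalingLimit
(Literature.Probability.LatticeModels.criticalCorr 3) ρ (D.corr h.sigmaField)) ∧ (∀ (ρ : ℝ → ℝ) (S :
Literature.Probability.LatticeModels.CorrFamily 3), (∀ δ ∈ Set.Ioc (0:ℝ) 1, 0 < ρ δ) →
Literature.Probability.LatticeModels.HasPointwiseScalingLimit
(Literature.Probability.LatticeModels.criticalCorr 3) ρ S →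
Literature.Probability.LatticeModels.IsNondegenerateTwoPoint S →
Literature.Probability.LatticeModels.HasNontrivialU4 S)`

## Assembly
CURRENT assembly items: stmt-0664 `Assembly` (rev-1 form ((CFT) ∧ (ND)) → conjunct; proved,
antecedent refuted) and stmt-0720 `Assembly2` (rev-2 form ((CFT) ∧ (ND′)) → conjunct; proved in tree
by conformalLimit_of_isCFT_and_ND'); the pending rev-3 package restates `Assembly` :=
IsingCFTDataR2IsCFT → IsingEuclidUpgradeR4NonGaussian → Ising3DConformalLimit (the type of `closes`)
and drops `Assembly2`. What decides the route is the PROVED deciding theorem `closes` (12 lines,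
axioms propext/Classical.choice/Quot.sound), pure unpacking of the CFT-data axioms: from the witness
(ρ, B, D, h) of crux #2 take S := D.corr σ and Δ := Δ_σ; Δ ∈ [1/2, 3)
(IsIsingLikeCFT.deltaSigma_mem_Ico) gives Δ > 0; IsUnitaryCFTData.isCovariant gives
IsMoebiusCovariant Δ S; IsUnitaryCFTData.twoPointNormalised gives S 2 ![x,y] = ‖x−y‖^(−2Δ) > 0, i.e.
IsNondegenerateTwoPoint S; crux #3 at (ρ, S) gives HasNontrivialU4 S; these are the six clauses of
Literature.Probability.LatticeModels.CritIsing3DConformalLimit = Ising3DConformalLimit.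

Rationale: WHY THIS LINE. The physics consensus (PolandRychkovVichi2019 §II; ElShowkEtAl2012;
KosPolandSimmonsDuffinVichi2016) is not merely that the 3-D Ising limit is Möbius covariant but that
it is a unitary CFT with convergent OPE, and the Literature types exactly this reading
(IsIsingLikeCFT, ConformalBlocks, CFTData; the named open conjecture crit-ising.S24). Taking the
identification itself as the rank-2 crux makes the assembly short and PROVED: covariance, Δ = Δ_σ >
0 and non-degeneracy are axioms of unitary CFT data (PolandRychkovVichi2019 §II.A eq. (7), §II.C eq.
(19), §II.D eq. (30)), so the only further lattice input is d = 3 non-Gaussianity (ND′), shared with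
route IsingEuclidUpgrade. Area imported: axiomatic Euclidean CFT / conformal bootstrap
(KravchukQiaoRychkov2021 for the OS/OPE side) plus random currents for U₄
(AizenmanDuminilCopinAnnals2021). Compared with IsingEuclidUpgrade (r6 Euclidean limit + r5′
inversion upgrade) this line trades the "scale ⇒ Möbius" crux for the OS-reconstruction /
state-operator content packed in S24; DuminilCopinICM2022 §8.4 (arXiv:2208.00864 p.29 line 1) names
proving that the critical 3D Ising model converges to a CFT as widely open — crux #2 is literally
that statement. Rev 3 changes no mathematics: it inlines S24 as the route's own item (the sibling
route did the same with S03) and drops items that are refuted as typed or are now proved Literature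
lemmas.

RANKED CRUXES. #0 IsingCFTDataThesisV2 (target) — X_I2 = (CFT) ∧ (ND′): the renormalised critical
Ising correlators on ℤ³ converge to the σ n-point functions of some Ising-like unitary ℤ₂-symmetric
3-D CFT data, and every non-degenerate pointwise scaling limit has U₄ ≢ 0 (conjunct 1 = crux #2
verbatim, conjunct 2 = crux #3 verbatim). (why it might fail: = #2 ∧ #3: fails if the ℤ³ limit is
not an Ising-like CFT as typed (no full-filter limit, S₂ not an exact power law, scale- but not
Möbius-covariant) or if some non-degenerate limit is Gaussian; both open (arXiv:2208.00864 p.29;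
arXiv:2309.05797 §1.1).) [DuminilCopinICM2022, arXiv:2208.00864, Panis2023Triviality,
arXiv:2309.05797]
#2 IsingCFTDataR2IsCFT (crux) — crit-ising.S24 (CURRENTLY typed `:=
Literature.MathematicalPhysics.QuantumFieldTheory.CritIsing3DIsCFT`; the pending rev-3 package
restates it INLINE, same Prop by Iff.rfl, so that the open conjecture is this route's own item and a
proof of the item discharges S24 verbatim): there exist ρ > 0 on (0,1], standard 3-D conformal
blocks B and Ising-like unitary ℤ₂-symmetric CFT data D (IsIsingLikeCFT B D) such that for every n
the rescaled critical Ising correlators ρ(δ)^n ⟨∏σ_{[x_i/δ]}⟩⁺_{β_c} on ℤ³ converge locally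
uniformly on non-coincident configurations to ⟨σ(x1)⋯σ(xn)⟩_D. Hardest and most informative: it
contains existence of the full pointwise limit, exact power law S₂ = ‖x−y‖^{−2Δσ} (so existence of η
= 2Δ_σ − 1), O(3) and inversion covariance, OS positivity and the spectrum/OPE clauses. [difficulty:
open-problem] (why it might fail: Needs the full-filter ℤ³ limit (all n), O(3)+inversion covariance
and S₂=‖x−y‖^{-2Δσ} exactly; on ℤ³ only c|x|⁻²≤G≤C|x|⁻¹ is proved, η not known to exist
(arXiv:2404.05700 Thm 1.5: η≤1/2 IF it exists); a scale- but non-Möbius limit (virial current) would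
falsify it — excluded only by MC.) [DuminilCopinICM2022, arXiv:2208.00864 §8.4 p.29,
DuminilCopinPanis2024, arXiv:2404.05700 Thm 1.5 p.6, MenesesEtAl2019, arXiv:1802.02319 p.2,
PolandRychkovVichi2019 §II–III, KravchukQiaoRychkov2021,
Literature.Probability.LatticeModels.criticalTwoPoint_bounds,
Literature.Barriers.CriticalPhenomena.BootstrapLatticeBlindness,
Literature.Barriers.CriticalPhenomena.ScaleCovarianceNotMoebius]
#3 IsingEuclidUpgradeR4NonGaussian (crux) — (ND′), shared item stmt-CriticalPhenomena-0636 (route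
IsingEuclidUpgrade r4 and ~10 other routes), unchanged: every non-degenerate pointwise scaling limit
S of the renormalised critical Ising correlators on ℤ³ has connected four-point function U₄ ≢ 0 on
non-coincident configurations. Tool: the random-current identity U₄(x,y,z,t) = −2⟨σxσy⟩⟨σzσt⟩·P[the
two double-current clusters meet] (Aizenman1982; AizenmanDuminilCopinAnnals2021 eq. (3.11));
non-Gaussianity ⇔ the macroscopic intersection probability does not vanish as δ → 0. [difficulty:
open-problem] (why it might fail: A non-degenerate d=3 limit may still be Gaussian: the one rigorous
handle on U₄ (random-current intersections) gives triviality for d≥4 (ADC 2021 Thm 1.2) and on ℤ³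
for RP long-range α<3/2 (Panis 2023 Thm 1.2); no macroscopic lower bound on double-current
intersections on ℤ³ is known.) [AizenmanDuminilCopinAnnals2021, arXiv:1912.07973 Thm 1.2 and eq.
(3.11), Panis2023Triviality, arXiv:2309.05797 Thm 1.2, AizenmanCDM2020 §11,
Literature.Probability.LatticeModels.ursellFour_eq_doubleCurrent,
Literature.Barriers.CriticalPhenomena.IsingTrivialityFromDimensionFour,
Literature.Barriers.CriticalPhenomena.LongRangeTrivialityOnZ3]
#9 IsingCFTDataR4NondegAnyLimit (support) — (item stmt-CriticalPhenomena-0667, unchanged;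
lattice-side non-degeneracy transfer, NOT on the critical path of `closes`) if a pointwise scaling
limit S of the critical Ising correlators on ℤ³ has S₂(x) > 0 at one non-coincident pair then S₂ > 0
at every non-coincident pair; intended inputs Griffiths/Simon–Lieb/MMS monotonicity and c|x|⁻² ≤
⟨σ0σx⟩_{βc} ≤ C|x|⁻¹; honest obstruction: up-to-constants doubling regularity of the critical
two-point function on ℤ³ is open. [difficulty: L]
[Literature.Probability.LatticeModels.criticalTwoPoint_bounds, DuminilCopinPanis2024,
arXiv:2404.05700 p.6]

TWO-LAYER PLAN. Foreseen glued split of crux #2 (k = 3, filed only when sibling r6 or part (a)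
moves): R2 ⇐ R2a → R2b → R2c → R2 with R2a = existence + Möbius covariance + OS positivity of the
full pointwise limit S normalised to 0 on the coincident locus (⊇ sibling IsingEuclidUpgrade r6 via
the proved Literature lemma CritIsing3DIsCFT.critIsing3DEuclideanLimit); R2b = such an S with S₂ an
exact power law is D.corr σ of SOME IsUnitaryCFTData (OS reconstruction / state-operator packaging,
KravchukQiaoRychkov2021); R2c = the ℤ₂/unique-relevant-scalar/OPE clauses of IsIsingLikeCFT for that
D (nearly vacuous for the v0 ConformalBlocks.IsStandard — refuter audit — and to be re-examined when
IsStandard becomes the Dolan–Osborn family).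

KILL CRITERIA. ¬IsingCFTDataR2IsCFT as typed (e.g. the ℤ³ limit exists but is scale- and not
Möbius-covariant, or S₂ is not an exact power law, or there are two relevant ℤ₂-even scalars): pivot
to a weaker CFT-data interface (IsUnitaryCFTData + a designated σ, uniqueness clauses dropped) as a
NEW item with new glue, or close `refuted:IsingCFTDataR2IsCFT` if the refutation hits the
covariance/power-law core. ¬IsingEuclidUpgradeR4NonGaussian (a non-degenerate Gaussian limit;
sibling item IsingEuclidUpgradeNegGaussianLimit) refutes the conjunct Ising3DConformalLimit itself
up to uniqueness of full-filter limits and closes every route of the sub-problem. If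
IsingEuclidUpgrade closes r6 + r4 + r5′ first the conjunct is settled and this route is superseded
(close `superseded --by route-CriticalPhenomena-IsingEuclidUpgrade`), crux #2 surviving as the
CFT-identification statement S24.

NOT DECOMPOSED YET. The internal structure of crux #2 (existence of the limit / OS reconstruction +
state-operator map / spectrum and OPE clauses — see Two-layer plan) until a crux or sibling r6
closes; OPE convergence and any numerics (BootstrapIsland, exponent values: irrelevant to the
conjunct, which needs SOME Δ > 0). To be DROPPED by the pending rev-3 package (still rendered in
this file until it is applied), deliberately not re-filed: the rev-1 target and (ND) (stmt-0663,
stmt-0666: refuted AS TYPED by the killing renormalisation, Theorems/IsingCFTDataRefutations.lean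
not_IsingCFTData_thesis / not_IsingCFTData_ND — the negative knowledge stays there; (ND′) = #3 is
the prescribed repair), the rev-2 twin assembly stmt-0720 Assembly2 (duplicate of the restated
Assembly; its in-tree proof conformalLimit_of_isCFT_and_ND' stays in
Theorems/IsingCFTDataAssembly.lean), the cross-route glue stmt-0740 S24 → S03 and the CFT-side
non-degeneracy stmt-0721 (both now PROVED Literature lemmas, CFTAxiomsProofs.lean:
CritIsing3DIsCFT.critIsing3DEuclideanLimit, IsUnitaryCFTData.isNondegenerateTwoPoint; the latter is
inlined in `closes`). REPAIR PENDING (route-repair seat rbadge g5, 2026-08-15): the verified rev-3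
package — restate IsingCFTDataR2IsCFT (stmt-0665) inline, restate IsingCFTDataThesisV2 (stmt-0719)
inline, restate Assembly (stmt-0664) := IsingCFTDataR2IsCFT → IsingEuclidUpgradeR4NonGaussian →
Ising3DConformalLimit, drop Assembly2 (stmt-0720, duplicate assembly), drop stmt-0663/0666 (refuted
as typed), stmt-0740/0721 (proved Literature lemmas), imports :=
[Literature.Probability.LatticeModels.ConformalBootstrap]; native preview: lean rc 0,
h21_check_closes ok, dependency cone 70 constants with NO conjecture leaf ⇒ staffable — is attached
as route evidence (edit.json + glue.lean + Route.md) but could not be applied by a planner: the gate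
bounces `drop_items`/`retriage` of any assembly-kind item ("the assembly item cannot be dropped /
retriaged") while validating every item edit for exactly one assembly ("route.multi-assembly: 2
assembly items"), a deadlock for this legacy two-assembly route. OPERATOR: drop stmt-0720
(Assembly2) — or allow the planner drop — then apply the attached edit.json with --closes-file
glue.lean verbatim.

CHEAPEST FALSIFIER. For the glue: none left — `closes` elaborates (lean check rc 0, standard
axioms). For crux #2 the cheap kills are spent: the killing-renormalisation junk that refuted (ND)
does not apply (twoPointNormalised pins ρ(δ)² G([x/δ],[y/δ]) → ‖x−y‖^{−2Δσ}), and the ∃-interface is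
inhabitable (generalised-free-field data satisfy IsIsingLikeCFT with v0 blocks; refuter audits
g3-2/g3-3 and the literature-prover census of 2026-08-14 on stmt-0665), so #2 is neither junk-true
nor junk-false; the next cheapest attack is a lookup for a rigorous scale-but-not-Möbius mechanism
on ℤ³ (none in print; the virial current is excluded only numerically, MenesesEtAl2019
arXiv:1802.02319 p.2). For crux #3: sibling item stmt-0645 (a non-degenerate Gaussian limit) is its
negation up to uniqueness of limits — expected false below the upper critical dimension.

NUMBERS. Rigorous on ℤ³: c|x|⁻² ≤ ⟨σ0σx⟩_{βc} ≤ C|x|⁻¹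
(Literature.Probability.LatticeModels.criticalTwoPoint_bounds; arXiv:2404.05700 p.4), hence Δ ∈
[1/2, 1] if it exists, and η ≤ 1/2 if it exists (arXiv:2404.05700 Thm 1.5, p.6). Unitarity bound
inside IsIsingLikeCFT: Δ_σ ∈ [1/2, 3). Numerics (not used): Δ_σ = 0.5181489(10), Δ_ε = 1.412625(10)
(KosPolandSimmonsDuffinVichi2016 §1).

DEFINITION REQUESTS. None new. Standing prelude debt (not filed here, recorded in CFTAxioms.lean /
ConformalBootstrap.lean): ConformalBlocks.IsStandard v0 records only normalisation + continuity, so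
the OPE/crossing clauses of crux #2 are weak until the Dolan–Osborn blocks are characterised.

Novelty: NOVELTY (retriage draft, search-before-claim: lit frontier/bridges CriticalPhenomena; lit search
local store; lean search).
Nearest prior art FOUND. Conjunct (CFT) of the thesis is verbatim the in-tree named conjecture
crit-ising.S24
`Literature.MathematicalPhysics.QuantumFieldTheory.CritIsing3DIsCFT` (CFTAxioms.lean:107), i.e. the
Poland–Rychkov–Vichi "CFT reading" of the 3D Ising
critical point [PolandRychkovVichi2019 §II, arXiv:1805.04405] whose lattice half Duminil-Copin lists
as "widely open …
two almost entirely disjoint questions" [DuminilCopinICM2022 §8.4, arXiv:2208.00864 p.29]. Conjunct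
(ND') = non-triviality
of non-degenerate 3D scaling limits, open in print ("the case d=3 remains open" [Panis2023Triviality
§1.1 fn.,
arXiv:2309.05797]; "3D … the hardest dimension to reach" [AizenmanCDM2020 §11]); its only rigorous
tool is the
random-current U₄ identity (Literature.Probability.LatticeModels.ursellFour_eq_doubleCurrent;
[AizenmanDuminilCopinAnnals2021, arXiv:1912.07973]).
Evidence for (CFT) is physical/numerical only: bootstrap island [KosPolandSimmonsDuffinVichi2016;
arXiv:2411.15300],
fuzzy-sphere conformal generators (arXiv:2210.13482), MC exclusion of a virial current Δ_V>5.0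
[MenesesEtAl2019,
arXiv:1802.02319 p.2], NPRG argument [DelamotteTissierWschebor2016]; lattice-side rigour on ℤ³ stops
at
c|x|⁻² ≤ ⟨σ0σx⟩_{βc} ≤ C|x|⁻¹ (Literature.Probability.LatticeModels.criticalTwoPoint_bounds) and "if
η exists, η ≤ 1/2" [arXiv:2404.05700 Thm 1.5].
Delta. No new mechanis  [refs: 1805.04405, 2208.00864, 2309.05797, 1912.07973, 2411.15300, 2210.13482, 1802.02319, 2404.05700, PolandRychkovVichi2019, DuminilCopinICM2022, AizenmanCDM2020, AizenmanDuminilCopinAnnals2021, KosPolandSimmonsDuffinVichi2016, MenesesEtAl2019, DelamotteTissierWschebor2016]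

Barriers (technique_class: cft-axiomatics, conformal-bootstrap, random-currents): BARRIERS (catalogue Literature/Barriers/CriticalPhenomena/; decl namespace
Literature.Barriers.CriticalPhenomena). One line each on evasion:
Literature.Barriers.CriticalPhenomena.BootstrapLatticeBlindness: NOT evaded — applies squarely
(no_bootstrap_derivation, transfer_needs_identification). Everything on the CFT side of this route
(IsIsingLikeCFT, ConformalBlocks.IsStandard, crossing, the island) is lattice-blind and cannot yield
HasConformalLimit (criticalCorr 3); the route takes the identification CritIsing3DIsCFT itself as
crux r2 (0665), which is exactly the barrier's "missing input", so no step infers lattice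
convergence from CFT-data constraints. The bet is only that the S24 packaging lets CFT axiomatics
[KravchukQiaoRychkov2021] absorb the covariance/non-degeneracy bookkeeping (done: Assembly2 and 0721
proved in tree) while all difficulty sits in the lattice-specific items 0665 ∧ 0636 (outside the
lattice-blind class by scope caveat (a)).
Literature.Barriers.CriticalPhenomena.ScaleCovarianceNotMoebius: formally sidestepped — no
Euclidean⇒Möbius upgrade step occurs (IsUnitaryCFTData.IsCovariant is an axiom of the witness D,
technique class EuclideanScaleUpgrade unused); not evaded in substance: proving 0665 needs inversion
covariance of the ℤ³ limit from Ising-specific input (RP, correlation inequalities, the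
scaling-limit hypothesis — the barrier's scope caveat (a)); physics evasions are non-rigorous
[DelamotteTissierWschebor2016 §6; MenesesEtAl2019 §1].
Literature.B

History (route lifecycle, newest last):
- 2026-08-15T18:06:45Z · CLOSED superseded — superseded:route-CriticalPhenomena-IsingEuclidUpgrade (planner-rbadge-CriticalPhenomena-IsingCFTData-341f5425-g6-0)

sub-problem: Ising3DConformalLimit · status: closed(superseded) · opened planner-CriticalPhenomena-Survey-0 2026-08-13T13:23:09Z · rev 4 · ledger route-CriticalPhenomena-IsingCFTData
GENERATED by the gate from the ledger (D-0016/17). Provers cite these decls: `theorem foo : Summit.CriticalPhenomena.Ising3DConformalLimit.Theses.IsingCFTData.<Decl> := …` in Summits/CriticalPhenomena/Ising3DConformalLimit/Theorems/<Name>.lean.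
-/

namespace Summit.CriticalPhenomena.Ising3DConformalLimit.Theses.IsingCFTData

open scoped BigOperators Topology Manifold Classical MeasureTheory ProbabilityTheory Matrix InnerProductSpace ComplexConjugate ContinuousMap
open Filter Set Function TopologicalSpace MeasureTheory

attribute [summit_statement] _root_.Ising3DConformalLimit

/-- item stmt-CriticalPhenomena-0663 · target · rank 0 · closed · moot by None · by planner
why it might fail: FALSE as typed — refuted in tree: CriticalPhenomena.IsingCFTData.not_IsingCFTData_thesis (conjunct (ND) ranges over every renormalisation ρ>0; a killing ρ gives a degenerate limit S₂≡0). Superseded by 0719 (v2). Ledger row still open = gate probe lag: close as refuted.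
sources: CriticalPhenomena.IsingCFTData.not_IsingCFTData_thesis, CriticalPhenomena.IsingCFTData.not_ND_of_ising3DConformalLimit, Summits/CriticalPhenomena/Ising3DConformalLimit/Theorems/IsingCFTDataRefutations.lean
X_I2 = CritIsing3DIsCFT ∧ (ND): the renormalised critical Ising correlators on Z^3 converge to the σ
n-point functions of an Ising-like unitary Z2-symmetric 3-D CFT data (Poland–Rychkov–Vichi 2019 §II
reading, CFTAxioms.lean), and every pointwise scaling limit is non-degenerate with U4 ≢ 0. -/
@[route_item "route-CriticalPhenomena-IsingCFTData"]
def IsingCFTDataThesis : Prop :=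
  Literature.MathematicalPhysics.QuantumFieldTheory.CritIsing3DIsCFT ∧ (∀ (ρ : ℝ → ℝ) (S : Literature.Probability.LatticeModels.CorrFamily 3), (∀ δ ∈ Set.Ioc (0:ℝ) 1, 0 < ρ δ) → Literature.Probability.LatticeModels.HasPointwiseScalingLimit (Literature.Probability.LatticeModels.criticalCorr 3) ρ S → Literature.Probability.LatticeModels.IsNondegenerateTwoPoint S ∧ Literature.Probability.LatticeModels.HasNontrivialU4 S)

/-- item stmt-CriticalPhenomena-0719 · target · rank 0 · closed · moot by None · by planner
why it might fail: = 0665 ∧ 0636. Fails if the ℤ³ critical limit is not an Ising-like CFT as typed (no full-space limit, S₂ not an exact power law, or scale- but not Möbius-covariant) or if some non-degenerate pointwise limit is Gaussian (U₄≡0); both open (ICM2022 §8.4 arXiv p.29; Panis 2023 §1.1 fn.).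
sources: DuminilCopinICM2022, arXiv:2208.00864 p.29, Panis2023Triviality, arXiv:2309.05797 §1.1, Literature.MathematicalPhysics.QuantumFieldTheory.CritIsing3DIsCFT, CriticalPhenomena.IsingCFTData.conformalLimit_of_isCFT_and_ND'
Thesis v2 (pivot; supersedes stmt-CriticalPhenomena-0663, refuted in tree by
not_IsingCFTData_thesis): X_I2' = CritIsing3DIsCFT ∧ (ND'), where (ND') = every NON-DEGENERATE
pointwise scaling limit (any ρ>0 on (0,1], S with S 2 > 0 off the diagonal) of the renormalised
critical Ising correlators on Z^3 has U4 ≢ 0 (= stmt-CriticalPhenomena-0636 verbatim).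
Non-degeneracy of the CFT limit is no longer demanded from the lattice side: it follows from
IsUnitaryCFTData.twoPointNormalised (D.corr σ 2 ![x,y] = ‖x−y‖^{−2Δσ} > 0). -/
@[route_item "route-CriticalPhenomena-IsingCFTData"]
def IsingCFTDataThesisV2 : Prop :=
  Literature.MathematicalPhysics.QuantumFieldTheory.CritIsing3DIsCFT ∧ (∀ (ρ : ℝ → ℝ) (S : Literature.Probability.LatticeModels.CorrFamily 3), (∀ δ ∈ Set.Ioc (0:ℝ) 1, 0 < ρ δ) → Literature.Probability.LatticeModels.HasPointwiseScalingLimit (Literature.Probability.LatticeModels.criticalCorr 3) ρ S → Literature.Probability.LatticeModels.IsNondegenerateTwoPoint S → Literature.Probability.LatticeModels.HasNontrivialU4 S)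

/-- item stmt-CriticalPhenomena-0665 · crux · rank 2 · closed · moot by None · by planner
why it might fail: Needs the full-space ℤ³ limit (all n) with O(3)+inversion covariance and S₂=|x|^{-2Δσ} exactly; on ℤ³ only c|x|⁻²≤G≤C|x|⁻¹ is proved, η not known to exist (DC–Panis 2024 Thm 1.5: 'if it exists, η≤1/2'); a scale- but non-Möbius limit (virial current) would falsify it — excluded only by MC (Δ_V>5.0).
sources: DuminilCopinICM2022, arXiv:2208.00864 §8.4 p.29, DuminilCopinPanis2024, arXiv:2404.05700 Thm 1.5, p.6, MenesesEtAl2019, arXiv:1802.02319 p.2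
Crux r2 (hardest): crit-ising.S24 CritIsing3DIsCFT — existence of standard conformal blocks B and
Ising-like unitary CFT data D (IsIsingLikeCFT B D) whose σ correlators are the pointwise scaling
limit of ρ(δ)^n⟨∏σ⟩_{β_c} on Z^3. 'Widely open' (Duminil-Copin ICM2022 arXiv:2208.00864 §8, p.40).
Internal structure (existence of limit / OS reconstruction + state-operator map / spectrum
assumptions) deliberately not decomposed until IsingEuclidUpgrade r2 or r6 closes. -/
@[route_item "route-CriticalPhenomena-IsingCFTData"]
def IsingCFTDataR2IsCFT : Prop :=
  Literature.MathematicalPhysics.QuantumFieldTheory.CritIsing3DIsCFT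

/-- item stmt-CriticalPhenomena-0636 · crux · rank 3 · open · by planner
why it might fail: A non-degenerate 3D limit may still be Gaussian: the one rigorous handle on U₄ (random-current intersections) gives triviality for d≥4 (ADC 2021 Thm 1.2) and even on ℤ³ for RP long-range α<3/2 (Panis 2023 Thm 1.2); no lower bound on current intersections at macroscopic scale on ℤ³ is known.
sources: AizenmanDuminilCopinAnnals2021, arXiv:1912.07973 Thm 1.2, Panis2023Triviality, arXiv:2309.05797 Thm 1.2, Prop 4.6, AizenmanCDM2020 §11, Literature.Probability.LatticeModels.ursellFour_eq_doubleCurrent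
Crux r4 (non-triviality in d=3): every non-degenerate pointwise scaling limit S of the renormalised
critical Ising correlators on Z^3 has connected four-point function U4 ≢ 0 on non-coincident
configurations. Intended tool: the random-current identity U4(x,y,z,t) =
−2⟨σxσy⟩⟨σzσt⟩·P^{xy,zt}[C_{n1+n2}(x) ∩ C_{n1+n2}(z) ≠ ∅] (Aizenman 1982; ADC2021 arXiv:1912.07973
eq. (3.11)): non-Gaussianity ⇔ the intersection probability of the two double-current clusters at
macroscopic separation does not vanish as δ → 0. Contrast: for d ≥ 4 every such limit IS Gaussian
(Literature.Probability.LatticeModels.highDim_triviality). Its negation refutes the conjunct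
Ising3DConformalLimit itself. -/
@[route_item "route-CriticalPhenomena-IsingCFTData"]
def IsingEuclidUpgradeR4NonGaussian : Prop :=
  ∀ (ρ : ℝ → ℝ) (S : Literature.Probability.LatticeModels.CorrFamily 3), (∀ δ ∈ Set.Ioc (0:ℝ) 1, 0 < ρ δ) → Literature.Probability.LatticeModels.HasPointwiseScalingLimit (Literature.Probability.LatticeModels.criticalCorr 3) ρ S → Literature.Probability.LatticeModels.IsNondegenerateTwoPoint S → Literature.Probability.LatticeModels.HasNontrivialU4 S

/-- item stmt-CriticalPhenomena-0666 · support · rank 3 · closed · moot by None · by planner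
why it might fail: FALSE as typed — refuted in tree: CriticalPhenomena.IsingCFTData.not_IsingCFTData_ND (killing renormalisation ρ(δ)=δ/B(⌈δ⁻²⌉) gives S₂≡0, so IsNondegenerateTwoPoint fails).
sources: CriticalPhenomena.IsingCFTData.not_IsingCFTData_ND
Crux r3 = (ND): every pointwise scaling limit S (any renormalisation ρ>0 on (0,1]) of the critical
Ising correlators on Z^3 is non-degenerate (S 2 > 0 off the diagonal) and non-Gaussian (U4 ≢ 0).
Non-degeneracy: Simon–Lieb lower bound c|x|^{-2} ≤ ⟨σ0σx⟩_{β_c} (criticalTwoPoint_bounds) plus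
convergence forces ρ(δ)²·cδ² ≲ S 2, which alone does not give positivity — the honest content is
that ρ must be ≍ the inverse square root of the two-point function at scale 1/δ; U4 part =
stmt-CriticalPhenomena-0636 (IsingEuclidUpgrade r4). Essential: a generalized free field satisfies
CritIsing3DIsCFT-type axioms with U4 ≡ 0. -/
@[route_item "route-CriticalPhenomena-IsingCFTData"]
def IsingCFTDataR3NondegNonGauss : Prop :=
  (∀ (ρ : ℝ → ℝ) (S : Literature.Probability.LatticeModels.CorrFamily 3), (∀ δ ∈ Set.Ioc (0:ℝ) 1, 0 < ρ δ) → Literature.Probability.LatticeModels.HasPointwiseScalingLimit (Literature.Probability.LatticeModels.criticalCorr 3) ρ S → Literature.Probability.LatticeModels.IsNondegenerateTwoPoint S ∧ Literature.Probability.LatticeModels.HasNontrivialU4 S)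

/-- item stmt-CriticalPhenomena-0667 · support · rank 4 · closed · moot by None · by planner
why it might fail: Needs up-to-constants doubling regularity g(2x)≍g(x) of ⟨σ0σx⟩_{βc} on ℤ³; in-tree inputs give only c|x|⁻²≤g≤C|x|⁻¹ (ρ(δ)/ρ(δ/2) uncontrolled), GKS/Simon–Lieb/MMS/RP admit profiles with unbounded doubling ratios (refuter g3-2); no pointwise d=3 lower bound beyond Simon's (DC–Panis 2024 p.6).
sources: Literature.Probability.LatticeModels.criticalTwoPoint_bounds, DuminilCopinPanis2024, arXiv:2404.05700 p.6 (no explicit d=3 pointwise bound), Thm 1.5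
Crux r4 (non-degeneracy transfer): if a pointwise scaling limit S of the critical Ising correlators
on Z^3 has S 2 x > 0 at one non-coincident pair then S 2 > 0 at every non-coincident pair. Lattice
inputs: Griffiths/Simon–Lieb (Literature.StatMech.simon_lieb, gks_two) and the two-sided bounds
c|x|^{-2} ≤ ⟨σ0σx⟩_{β_c} ≤ C|x|^{-1} (Literature.Probability.LatticeModels.criticalTwoPoint_bounds),
which bound ratios ⟨σ0σx⟩/⟨σ0σy⟩ for comparable |x|,|y| uniformly in the scale. -/
@[route_item "route-CriticalPhenomena-IsingCFTData"]
def IsingCFTDataR4NondegAnyLimit : Prop :=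
  ∀ (ρ : ℝ → ℝ) (S : Literature.Probability.LatticeModels.CorrFamily 3), (∀ δ ∈ Set.Ioc (0:ℝ) 1, 0 < ρ δ) → Literature.Probability.LatticeModels.HasPointwiseScalingLimit (Literature.Probability.LatticeModels.criticalCorr 3) ρ S → (∃ x ∈ Literature.Probability.LatticeModels.NonCoincident 3 2, 0 < S 2 x) → Literature.Probability.LatticeModels.IsNondegenerateTwoPoint S

/-- item stmt-CriticalPhenomena-0721 · support · rank 4 · closed · moot by None · by planner
sources: CriticalPhenomena.IsingCFTData.isNondegenerateTwoPoint_of_isUnitaryCFTData, PolandRychkovVichi2019 §II.D eq. (30)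
Crux r4 v2 (glue, expected provable in one pass; Literature-promotable to CFTData.lean): in unitary
CFT data every scalar primary has a non-degenerate two-point function, 0 < D.corr i 2 x for x ∈
NonCoincident d 2. Proof: x 0 ≠ x 1, rewrite x = ![x 0, x 1] (funext + Fin.cases),
IsUnitaryCFTData.twoPointNormalised gives D.corr i 2 ![x 0, x 1] = ‖x 0 − x 1‖ ^ (−2 * D.Δ i),
positive by Real.rpow_pos_of_pos (norm_pos_iff / sub_ne_zero). (Poland–Rychkov–Vichi 2019 §II.D eq.
(30).) Used by assembly v2 with d = 3, i = h.sigmaField, spin σ = 0 from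
IsIsingLikeCFT.sigmaField_spec.1. Replaces the lattice-side transfer stmt-CriticalPhenomena-0667 on
the critical path. -/
@[route_item "route-CriticalPhenomena-IsingCFTData"]
def IsingCFTDataR4CftNondegenerate : Prop :=
  ∀ (d : ℕ) (D : Literature.Probability.LatticeModels.CFTData d), Literature.Probability.LatticeModels.IsUnitaryCFTData D → ∀ i : D.ι, D.spin i = 0 → Literature.Probability.LatticeModels.IsNondegenerateTwoPoint (D.corr i)

/-- item stmt-CriticalPhenomena-0740 · support · rank 9 · closed · moot by None · by planner
sources: Literature.MathematicalPhysics.QuantumFieldTheory.CritIsing3DIsCFT.exists_isMoebiusCovariant, Literature.Probability.LatticeModels.conformalLimit_implies_euclidean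
[support] r9 cross-route glue: crux IsCFT (CritIsing3DIsCFT, item 0665) subsumes IsingEuclidUpgrade
r6 (CritIsing3DEuclideanLimit, item 0638): unpack ⟨ρ,B,D,h,hρ,-,hlim⟩; Δ := h.deltaSigma > 0
(deltaSigma_mem_Ico); Euclidean invariance and scale covariance are the first two projections of
IsUnitaryCFTData.isCovariant σ (IsMoebiusCovariant); non-degeneracy from the CFT side
(isNondegenerateTwoPoint_of_isUnitaryCFTData, Theorems/IsingCFTDataAssembly.lean). 6-line term,
verified in planner Sketch.lean. Purpose: (i) records IsCFT ⊇ 0638 so effort is not duplicated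
across the two routes; (ii) this item CARRIES the route import
Literature.MathematicalPhysics.QuantumFieldTheory.CFTAxioms that the route file lacks (route
NEEDS-MATERIALISE: Unknown identifier
Literature.MathematicalPhysics.QuantumFieldTheory.CritIsing3DIsCFT) — the next statement close on
this route re-renders the file with it. -/
@[route_item "route-CriticalPhenomena-IsingCFTData"]
def IsCFTImpliesEuclideanLimit : Prop :=
  Literature.MathematicalPhysics.QuantumFieldTheory.CritIsing3DIsCFT → Literature.Probability.LatticeModels.CritIsing3DEuclideanLimit

/-- item stmt-CriticalPhenomena-0664 · assembly · rank 1 · closed · proved by CriticalPhenomena.IsingCFTData.conformalLimit_of_isCFT_and_ND (refuter) · by planner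
Assembly: X_I2 → Ising3DConformalLimit (4th conjunct). From
CritIsing3DIsCFT.exists_isMoebiusCovariant (PROVED in
Literature/MathematicalPhysics/QuantumFieldTheory/CFTAxioms.lean) get ρ, Δ ∈ [1/2,3) (so Δ > 0), S
with HasPointwiseScalingLimit and IsMoebiusCovariant Δ S; apply (ND) to (ρ,S) for
IsNondegenerateTwoPoint and HasNontrivialU4. Needs import
Literature.MathematicalPhysics.QuantumFieldTheory.CFTAxioms. -/
@[route_item "route-CriticalPhenomena-IsingCFTData"]
def Assembly : Prop :=
  (Literature.MathematicalPhysics.QuantumFieldTheory.CritIsing3DIsCFT ∧ (∀ (ρ : ℝ → ℝ) (S : Literature.Probability.LatticeModels.CorrFamily 3), (∀ δ ∈ Set.Ioc (0:ℝ) 1, 0 < ρ δ) → Literature.Probability.LatticeModels.HasPointwiseScalingLimit (Literature.Probability.LatticeModels.criticalCorr 3) ρ S → Literature.Probability.LatticeModels.IsNondegenerateTwoPoint S ∧ Literature.Probability.LatticeModels.HasNontrivialU4 S)) → Ising3DConformalLimit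

/-- `Assembly` holds: proved by `CriticalPhenomena.IsingCFTData.conformalLimit_of_isCFT_and_ND`. -/
theorem Assembly_holds : Assembly := _root_.CriticalPhenomena.IsingCFTData.conformalLimit_of_isCFT_and_ND

/-- item stmt-CriticalPhenomena-0720 · assembly · rank 1 · closed · moot by None · by planner
Assembly v2: X_I2' → Ising3DConformalLimit. Unpack CritIsing3DIsCFT as ⟨ρ, B, D, h, hρ, -, hlim⟩; S
:= D.corr h.sigmaField, Δ := h.deltaSigma ∈ Ico (1/2) 3 (h.deltaSigma_mem_Ico, so 0 < Δ);
IsMoebiusCovariant Δ S from h.isUnitaryCFTData.isCovariant h.sigmaField h.sigmaField_spec.1 (as in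
CritIsing3DIsCFT.exists_isMoebiusCovariant, CFTAxioms.lean:117); IsNondegenerateTwoPoint S from the
CFT side (r4 item IsingCFTData_r4_cftNondegenerate: twoPointNormalised + spin σ = 0 +
Real.rpow_pos_of_pos); HasNontrivialU4 S from (ND') at (ρ,S). Pattern:
Theorems/IsingCFTData/Assembly.lean (v1, vacuous). Imports
Literature.MathematicalPhysics.QuantumFieldTheory.CFTAxioms. -/
@[route_item "route-CriticalPhenomena-IsingCFTData"]
def Assembly2 : Prop :=
  (Literature.MathematicalPhysics.QuantumFieldTheory.CritIsing3DIsCFT ∧ (∀ (ρ : ℝ → ℝ) (S : Literature.Probability.LatticeModels.CorrFamily 3), (∀ δ ∈ Set.Ioc (0:ℝ) 1, 0 < ρ δ) → Literature.Probability.LatticeModels.HasPointwiseScalingLimit (Literature.Probability.LatticeModels.criticalCorr 3) ρ S → Literature.Probability.LatticeModels.IsNondegenerateTwoPoint S → Literature.Probability.LatticeModels.HasNontrivialU4 S)) → Ising3DConformalLimit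

end Summit.CriticalPhenomena.Ising3DConformalLimit.Theses.IsingCFTData
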